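import Summits.QuantumFields.YangMills.Theorems.PencilRigidityNPointIsotropyDegreeLeTwo
import Literature.MathematicalPhysics.QuantumFieldTheory.OSLorentzInvariance
import HarnessLib

/-!
# `NPointIsotropy` — DEGREE 0 of the analytic input (doubled orbit kernel), trivially

Support file for crux `stmt-QuantumFields-11686` (`PencilRigidity.NPointIsotropy`), line `complex-rotation-bandlimit`,
lead c3 (generation 9).  The shared analytic stub `stub_doubledOrbitKernel` asks, in every degree `n`, for a uniform type
`N` and, for every compactly supported time-ordered `F` of degree `n`, a rotation margin `ε` and a doubled orbit kernel
`K(η', η) = 𝔖_{2n}(Θ(R_{η'}F)* ⊗ R_η F)` jointly holomorphic on the strip square with `‖K(θ̄, θ)‖ ≤ C e^{2N|Im θ|}`.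
The composition of the line consumes it in EVERY degree (the level-`a` step of the sieve pairs a degree-`a` block with
blocks of all degrees `≤ a`, including `0`).  Degree `1` is the landed `doubledOrbitKernel_degOne` (p119427); degrees
`≥ 2` are the registered residual `stub_doubledOrbitKernelHigh`; this file is degree `0`, where everything is constant:
`Fin 0 → ℝ⁴` is a one-point space, `linActMulti R F = F` (`DegreeLeTwo.linActMulti_fin_zero`), time-ordering is
vacuous, every witness of `ΘF* ⊗ F` is one and the same Schwartz map, and the kernel is the constant `𝔖₀(ΘF* ⊗ F)`
(type `N = 0`). [folklore]
-/

noncomputable section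

namespace Summit.QuantumFields.YangMills.Theorems.NPointIsotropy.ComplexRotationBandlimit

open scoped SchwartzMap
open Literature.MathematicalPhysics.QuantumLattice Literature.MathematicalPhysics.AQFT
  Literature.MathematicalPhysics.QuantumFieldTheory
open Summit.QuantumFields.YangMills.Theorems.NPointIsotropy.Negative (E4)

/-- In degree `0` every test function is time-ordered (both clauses quantify over `Fin 0`). [folklore] -/
theorem isTimeOrdered_fin_zero (F : 𝓢((Fin 0 → E4), ℂ)) : IsTimeOrdered F :=
  fun _ _ => ⟨fun i => Fin.elim0 i, fun i => Fin.elim0 i⟩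

/-- In degree `0 + 0` two append-tensor witnesses of the same pair coincide (indeed any two witnesses of any two pairs
with equal factors do): the values agree pointwise. [folklore] -/
theorem isAppendTensorOf_unique_fin_zero {H H' : 𝓢((Fin (0 + 0) → E4), ℂ)} {A A' B B' : 𝓢((Fin 0 → E4), ℂ)}
    (hH : IsAppendTensorOf H A B) (hH' : IsAppendTensorOf H' A' B') (hA : A = A') (hB : B = B') : H = H' := by
  subst hA hB
  ext x
  rw [hH x, hH' x]

/-- **Degree 0 of the doubled orbit kernel** (registered sub-goal `doubledOrbitKernel_degZero` of stmt-QuantumFields-11686):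
for EVERY Schwinger family on `ℝ⁴` (no hypothesis at all), the `n = 0` case of the shared analytic stub
`stub_doubledOrbitKernel` holds with type `N = 0`, margin `ε = 1` and the constant kernel `K ≡ 𝔖₀(ΘF* ⊗ F)`. [folklore] -/
theorem doubledOrbitKernel_degZero : ∀ (S₁ : Literature.MathematicalPhysics.QuantumLattice.SchwingerFamily (EuclideanSpace ℝ (Fin 4))), ∃ N : ℝ, ∀ (F : SchwartzMap (Fin 0 → EuclideanSpace ℝ (Fin 4)) ℂ), Literature.MathematicalPhysics.QuantumLattice.IsTimeOrdered F → HasCompactSupport (F : (Fin 0 → EuclideanSpace ℝ (Fin 4)) → ℂ) → ∃ ε : ℝ, 0 < ε ∧ (∀ η : ℝ, |η| < ε → Literature.MathematicalPhysics.QuantumLattice.IsTimeOrdered (Literature.MathematicalPhysics.QuantumLattice.linActMulti (Literature.MathematicalPhysics.QuantumFieldTheory.planeRot (0 : Fin 3) η) F)) ∧ ∃ (K : ℂ → ℂ → ℂ) (C : ℝ), DifferentiableOn ℂ (Function.uncurry K) ({z : ℂ | |z.re| < ε} ×ˢ {z : ℂ | |z.re| < ε}) ∧ (∀ θ : ℂ,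 |θ.re| < ε → ‖K (starRingEnd ℂ θ) θ‖ ≤ C * Real.exp (2 * N * |θ.im|)) ∧ ∀ η η' : ℝ, |η| < ε → |η'| < ε → ∀ H : SchwartzMap (Fin (0 + 0) → EuclideanSpace ℝ (Fin 4)) ℂ, Literature.MathematicalPhysics.QuantumLattice.IsAppendTensorOf H (Literature.MathematicalPhysics.QuantumLattice.osAdjoint (Literature.MathematicalPhysics.QuantumLattice.linActMulti (Literature.MathematicalPhysics.QuantumFieldTheory.planeRot (0 : Fin 3) η') F)) (Literature.MathematicalPhysics.QuantumLattice.linActMulti (Literature.MathematicalPhysics.QuantumFieldTheory.planeRot (0 : Fin 3) η) F) → K η' η = S₁ (0 + 0) H := by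
  intro S₁
  refine ⟨0, fun F _ _ => ?_⟩
  -- one fixed witness of `ΘF* ⊗ F`; the kernel is the constant `𝔖₀` of it
  obtain ⟨H₀, hH₀⟩ := exists_isAppendTensorOf (osAdjoint F) F
  refine ⟨1, one_pos, fun η _ => isTimeOrdered_fin_zero _, fun _ _ => S₁ (0 + 0) H₀, ‖S₁ (0 + 0) H₀‖,
    differentiableOn_const _, fun θ _ => ?_, fun η η' _ _ H hH => ?_⟩
  · simp
  · -- every rotated witness is `H₀`: `linActMulti R F = F` in degree `0`
    have hη : linActMulti (planeRot (0 : Fin 3) η) F = F := DegreeLeTwo.linActMulti_fin_zero _ F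
    have hη' : linActMulti (planeRot (0 : Fin 3) η') F = F := DegreeLeTwo.linActMulti_fin_zero _ F
    exact congrArg (S₁ (0 + 0)) (isAppendTensorOf_unique_fin_zero hH hH₀ (by rw [hη']) hη).symm

end Summit.QuantumFields.YangMills.Theorems.NPointIsotropy.ComplexRotationBandlimit

end
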